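import Summits.ValiantsHypothesis.ValiantsHypothesis.Theorems.LacunarySymmetroidMatrixDescartesDoorA26WallBubblingSignCut
import Summits.ValiantsHypothesis.ValiantsHypothesis.Theorems.LacunarySymmetroidMatrixDescartesDoorA26WallBubblingExpSumLocalSigns

/-!
# `DoorA26` / line `wall_bubbling` — MIXED KIT II: Descartes with DOUBLE zeros for exponential sums, the PARITY WALK, sign cuts at chosen gap
points, FLIP WITNESSES for the node-twisted test function

HONEST FRAMING.  Object-search cell `pub-symmetroid`, crux `Theses.LacunarySymmetroid.DoorA26` (stmt-ValiantsHypothesis-19979; OPEN, typed,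
never asserted).  W2 seat val-sym-door-p1 g19; def-free helper for obligation (R) of `Cruxes/DoorA26/Lines/wall_bubbling.lean`.  File #59 of
the MIXED chain #58–#63.  Imports #54 `…SignCut` and #56 `…ExpSumLocalSigns`.

WHAT IS HERE.  ★ `card_zeros_add_card_double_le` (a non-trivial `(K+1)`-term real exponential sum with strictly increasing exponents, vanishing on
`Z` and with vanishing derivative on `Zd ⊆ Z`, has `|Z| + |Zd| ≤ K`: twist by `e^{−δ₀t}`, differentiate to a `K`-term sum, count Rolle points
(`Bubbling.rolle_count_fin`) plus double zeros, `expCoeff_eq_zero_of_zeros`); ★ `sign_walk` (a continuous `g` whose zeros on `[x,y]` form a finite set of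
SIMPLE zeros strictly inside has `sgn g(y) = (−1)^{#zeros} sgn g(x)` — `Finset.induction_on_min`); `signCutAt` (#54 `signCut` with an arbitrary choice
of one point inside each consecutive gap); ★ `exists_flipWitness` (if the node-twisted values `g·∏(n − ·)` of `g = expSum a x` — vanishing at the nodes
— have opposite signs at `s < t`, then strictly between there is a NON-node zero of `g` or a node where `g′ = 0` too).  Nothing here bears on `DoorA26`, `DoorA34`, (W)/(M)/(R) as typed, `MatrixDescartes` (18050) or `VP ≠ VNP`; registers unchanged.

[folklore] Rolle, Laguerre's count, intermediate value theorem.  [this work] the packaging.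
-/

set_option linter.dupNamespace false

namespace Summit.ValiantsHypothesis.ValiantsHypothesis.Theorems.LacunarySymmetroidMatrixDescartes.WallBubbling

open Finset Filter Topology
open Bubbling (polar polar_apply expSum hasDerivAt_expSum)

/-! ## §2 Descartes with double zeros for real exponential sums -/

/-- **Laguerre–Descartes with double zeros.**  A non-trivial `(K+1)`-term real exponential sum with strictly increasing exponents,
vanishing on a finite set `Z` and with vanishing derivative on `Zd ⊆ Z`, has `|Z| + |Zd| ≤ K`.  (Twist by `e^{−δ₀t}`, differentiate —
a `K`-term sum — and count: Rolle points between consecutive zeros plus the double zeros.) [folklore] -/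
theorem card_zeros_add_card_double_le {K : ℕ} (δ : Fin (K + 1) → ℝ) (hd : StrictMono δ) (c : Fin (K + 1) → ℝ) (hc : c ≠ 0)
    (Z : Finset ℝ) (hZ : ∀ z ∈ Z, ∑ l, c l * Real.exp (δ l * z) = 0)
    (Zd : Finset ℝ) (hZd : Zd ⊆ Z) (hZd' : ∀ z ∈ Zd, ∑ l, c l * δ l * Real.exp (δ l * z) = 0) :
    Z.card + Zd.card ≤ K := by
  classical
  by_cases hZe : Z = ∅
  · subst hZe; rw [Finset.subset_empty.1 hZd]; simp
  obtain ⟨m, hm⟩ : ∃ m, Z.card = m + 1 := ⟨Z.card - 1, by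
    have := Finset.card_pos.2 (Finset.nonempty_iff_ne_empty.2 hZe); omega⟩
  -- the twisted sum `v(t) = Σ c_l e^{(δ_l − δ₀) t}` and its derivative, a `K`-term sum
  set δ' : Fin K → ℝ := fun i => δ i.succ - δ 0 with hδ'
  set c' : Fin K → ℝ := fun i => c i.succ * (δ i.succ - δ 0) with hc'
  have hd' : StrictMono δ' := fun i j hij => by
    simp only [hδ']; linarith [hd (Fin.succ_lt_succ_iff.2 hij)]
  set v : ℝ → ℝ := expSum c (fun l => δ l - δ 0) with hv
  set v' : ℝ → ℝ := fun t => ∑ i, c' i * Real.exp (δ' i * t) with hv'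
  have hvd : ∀ t, HasDerivAt v (v' t) t := by
    intro t
    have h := hasDerivAt_expSum c (fun l => δ l - δ 0) t
    have heq : expSum (fun i => c i * (δ i - δ 0)) (fun l => δ l - δ 0) t = v' t := by
      simp only [hv', expSum, Fin.sum_univ_succ, sub_self, mul_zero, zero_mul, zero_add, hc', hδ']
    rw [heq] at h; exact h
  have hvz : ∀ z ∈ Z, v z = 0 := by
    intro z hz
    have : v z = Real.exp (-(δ 0) * z) * ∑ l, c l * Real.exp (δ l * z) := by
      simp only [hv, expSum, Finset.mul_sum]
      refine Finset.sum_congr rfl fun l _ => ?_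
      rw [sub_mul, Real.exp_sub, neg_mul, Real.exp_neg]; field_simp
    rw [this, hZ z hz, mul_zero]
  have hv'z : ∀ z ∈ Zd, v' z = 0 := by
    intro z hz
    have h1 : v' z = ∑ l, c l * (δ l - δ 0) * Real.exp ((δ l - δ 0) * z) := by
      rw [Fin.sum_univ_succ]
      simp only [hv', hc', hδ', sub_self, mul_zero, zero_mul, zero_add]
    have h2 : ∑ l, c l * (δ l - δ 0) * Real.exp ((δ l - δ 0) * z) =
        Real.exp (-(δ 0) * z) * ((∑ l, c l * δ l * Real.exp (δ l * z)) - δ 0 * ∑ l, c l * Real.exp (δ l * z)) := by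
      rw [Finset.mul_sum, mul_sub, Finset.mul_sum, Finset.mul_sum, ← Finset.sum_sub_distrib]
      refine Finset.sum_congr rfl fun l _ => ?_
      rw [sub_mul (δ l) (δ 0) z, Real.exp_sub, neg_mul, Real.exp_neg]
      field_simp
    rw [h1, h2, hZd' z hz, hZ z (hZd hz)]
    ring
  -- Rolle points between consecutive zeros
  let e : Fin (m + 1) ↪o ℝ := Z.orderEmbOfFin hm
  obtain ⟨r, hrmono, hrbetween, hr0⟩ :=
    Bubbling.rolle_count_fin hvd e e.strictMono (fun i => hvz _ (Z.orderEmbOfFin_mem hm i))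
  -- the zero set of `v'`: Rolle points and double zeros, all distinct
  set W : Finset ℝ := (Finset.univ.image r) ∪ Zd with hW
  have hrZ : ∀ k, r k ∉ Z := by
    intro k hk
    obtain ⟨i, hi⟩ : ∃ i, e i = r k := by
      have : r k ∈ Set.range e := by rw [Finset.range_orderEmbOfFin]; exact hk
      exact this
    have h1 := (hrbetween k).1; have h2 := (hrbetween k).2
    rw [← hi] at h1 h2
    have i1 : k.castSucc < i := e.lt_iff_lt.1 h1
    have i2 : i < k.succ := e.lt_iff_lt.1 h2
    rw [Fin.lt_def, Fin.val_castSucc] at i1; rw [Fin.lt_def, Fin.val_succ] at i2; omega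
  have hWcard : W.card = m + Zd.card := by
    rw [hW, Finset.card_union_of_disjoint, Finset.card_image_of_injective _ hrmono.injective, Finset.card_univ,
      Fintype.card_fin]
    exact Finset.disjoint_left.2 fun x hx hx' => by
      obtain ⟨k, -, rfl⟩ := Finset.mem_image.1 hx; exact hrZ k (hZd hx')
  have hWz : ∀ w ∈ W, v' w = 0 := by
    intro w hw
    rcases Finset.mem_union.1 hw with hw | hw
    · obtain ⟨k, -, rfl⟩ := Finset.mem_image.1 hw; exact hr0 k
    · exact hv'z w hw
  -- if `v'` had `K` distinct zeros it would vanish identically, forcing `c = 0`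
  by_contra hlt
  have hK : K ≤ W.card := by omega
  obtain ⟨W', hW', hW'card⟩ := Finset.exists_subset_card_eq hK
  let zf : Fin K → ℝ := fun i => W'.orderEmbOfFin hW'card i
  have hzf : Function.Injective zf := (W'.orderEmbOfFin hW'card).injective
  have hcoef := expCoeff_eq_zero_of_zeros δ' hd'.injective zf hzf c' (fun i => hWz _ (hW' (W'.orderEmbOfFin_mem hW'card i)))
  have hcsucc : ∀ i : Fin K, c i.succ = 0 := by
    intro i
    have h := congrFun hcoef i
    simp only [hc', Pi.zero_apply] at h
    rcases mul_eq_zero.1 h with h | h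
    · exact h
    · exact absurd h (ne_of_gt (sub_pos.2 (hd (Fin.succ_pos i))))
  -- then `g = c₀ e^{δ₀ t}` vanishes at a point of `Z`, so `c₀ = 0`
  obtain ⟨z, hz⟩ := Finset.nonempty_iff_ne_empty.2 hZe
  have h0 : c 0 = 0 := by
    have := hZ z hz
    rw [Fin.sum_univ_succ] at this
    simp only [hcsucc, zero_mul, Finset.sum_const_zero, add_zero] at this
    rcases mul_eq_zero.1 this with h | h
    · exact h
    · exact absurd h (Real.exp_pos _).ne'
  exact hc (funext fun l => by
    rcases Fin.eq_zero_or_eq_succ l with rfl | ⟨i, rfl⟩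
    · exact h0
    · exact hcsucc i)

/-! ## §3 The parity walk: a continuous function changes sign exactly at its simple zeros -/

/-- **Parity walk.**  `g` continuous on `[x, y]`, all its zeros there lie in a finite set `Nset ⊆ (x, y)` of SIMPLE zeros (each with
a one-sided sign pattern `d·g > 0` just right, `< 0` just left); then `sgn g(y) = (−1)^{|Nset|} sgn g(x)`. [folklore] -/
theorem sign_walk (g : ℝ → ℝ) (hg : Continuous g) (y : ℝ) (Nset : Finset ℝ)
    (hsimple : ∀ a ∈ Nset, ∃ d η : ℝ, 0 < η ∧ (∀ t, a < t → t < a + η → 0 < d * g t) ∧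
      (∀ t, a - η < t → t < a → d * g t < 0)) :
    ∀ x, x < y → (∀ a ∈ Nset, x < a ∧ a < y) → (∀ t, x ≤ t → t ≤ y → g t = 0 → t ∈ Nset) →
      0 < g x * g y * (-1) ^ Nset.card := by
  classical
  induction Nset using Finset.induction_on_min with
  | empty =>
    intro x hxy _ hz
    rw [Finset.card_empty, pow_zero, mul_one]
    exact mul_pos_of_no_zero hg hxy.le fun t h1 h2 h3 => Finset.notMem_empty t (hz t h1 h2 h3)
  | insert a s has ih =>
    intro x hxy hin hz
    have hanot : a ∉ s := fun h => lt_irrefl a (has a h)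
    obtain ⟨hxa, hay⟩ := hin a (Finset.mem_insert_self a s)
    obtain ⟨d, η, hη, hR, hL⟩ := hsimple a (Finset.mem_insert_self a s)
    -- the next obstacle to the right of `a`: the least element of `s`, or `y`
    set m : ℝ := if h : s.Nonempty then s.min' h else y with hm
    have ham : a < m := by
      simp only [hm]; split_ifs with h
      · exact has _ (Finset.min'_mem s h)
      · exact hay
    have hmy : m ≤ y := by
      simp only [hm]; split_ifs with h
      · exact (hin _ (Finset.mem_insert_of_mem (Finset.min'_mem s h))).2.le
      · exact le_rfl
    have hms : ∀ b ∈ s, m ≤ b := fun b hb => by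
      simp only [hm]; rw [dif_pos ⟨b, hb⟩]; exact Finset.min'_le s b hb
    -- probe points
    set t₁ := a - min (η / 2) ((a - x) / 2) with ht₁
    set t₂ := a + min (η / 2) ((m - a) / 2) with ht₂
    have h1x : x < t₁ := by have := min_le_right (η / 2) ((a - x) / 2); rw [ht₁]; linarith
    have h1a : t₁ < a := by have := lt_min (half_pos hη) (half_pos (sub_pos.2 hxa)); rw [ht₁]; linarith
    have h1η : a - η < t₁ := by have := min_le_left (η / 2) ((a - x) / 2); rw [ht₁]; linarith
    have h2a : a < t₂ := by have := lt_min (half_pos hη) (half_pos (sub_pos.2 ham)); rw [ht₂]; linarith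
    have h2m : t₂ < m := by have := min_le_right (η / 2) ((m - a) / 2); rw [ht₂]; linarith
    have h2η : t₂ < a + η := by have := min_le_left (η / 2) ((m - a) / 2); rw [ht₂]; linarith
    -- (1) no zero on `[x, t₁]`
    have hseg1 : 0 < g x * g t₁ := mul_pos_of_no_zero hg h1x.le fun t ht1 ht2 hgt => by
      have hmem := hz t ht1 (by linarith) hgt
      rcases Finset.mem_insert.1 hmem with rfl | hts
      · linarith
      · have := hms t hts; linarith
    -- (2) across `a`
    have hL1 := hL t₁ h1η h1a
    have hR2 := hR t₂ h2a h2η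
    -- (3) induction hypothesis from `t₂`
    have ih' := ih (fun b hb => hsimple b (Finset.mem_insert_of_mem hb)) t₂ (lt_of_lt_of_le h2m hmy)
      (fun b hb => ⟨lt_of_lt_of_le h2m (hms b hb), (hin b (Finset.mem_insert_of_mem hb)).2⟩)
      (fun t ht1 ht2 hgt => by
        have hmem := hz t (by linarith) ht2 hgt
        rcases Finset.mem_insert.1 hmem with rfl | hts
        · linarith
        · exact hts)
    rw [Finset.card_insert_of_notMem hanot, pow_succ]
    -- combine signs: (g x g t₁) > 0, (d g t₁)(d g t₂) < 0, (g t₂ g y (-1)^|s|) > 0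
    have hmid : d * g t₁ * (d * g t₂) < 0 := mul_neg_of_neg_of_pos hL1 hR2
    have key : (g x * g t₁) * (-(d * g t₁ * (d * g t₂))) * (g t₂ * g y * (-1) ^ s.card) =
        (g x * g y * ((-1) ^ s.card * -1)) * (g t₁ * g t₁ * (d * d) * (g t₂ * g t₂)) := by ring
    have hpos : 0 < (g x * g t₁) * (-(d * g t₁ * (d * g t₂))) * (g t₂ * g y * (-1) ^ s.card) :=
      mul_pos (mul_pos hseg1 (by linarith)) ih'
    rw [key] at hpos
    have hnn : 0 ≤ g t₁ * g t₁ * (d * d) * (g t₂ * g t₂) :=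
      mul_nonneg (mul_nonneg (mul_self_nonneg _) (mul_self_nonneg _)) (mul_self_nonneg _)
    exact pos_of_mul_pos_left hpos hnn

/-! ## §4 Sign cuts at chosen gap points -/

/-- **SIGN CUT AT CHOSEN GAP POINTS** (variant of #54 `signCut`): with ANY choice of one point `p i` strictly inside each consecutive gap of
`A`, the set `W` of chosen points over the flip gaps has `|W| = #flips`, lies off the abscissae of `A`, and cuts out the sign word of `f`
along `A`. [folklore] -/
theorem signCutAt {N k : ℕ} (τ : Fin N → ℝ) (hτ : StrictMono τ) (A : Finset (Fin N)) (h : A.card = k + 1)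
    (f : Fin N → ℝ) (hf : ∀ j ∈ A, f j ≠ 0) (p : Fin k → ℝ)
    (hp : ∀ i, τ (A.orderEmbOfFin h i.castSucc) < p i ∧ p i < τ (A.orderEmbOfFin h i.succ)) :
    ((Finset.univ.filter fun i : Fin k =>
        f (A.orderEmbOfFin h i.castSucc) * f (A.orderEmbOfFin h i.succ) < 0).image p).card =
      (Finset.univ.filter fun i : Fin k =>
        f (A.orderEmbOfFin h i.castSucc) * f (A.orderEmbOfFin h i.succ) < 0).card ∧
    (∀ j ∈ A, ∀ x ∈ (Finset.univ.filter fun i : Fin k =>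
        f (A.orderEmbOfFin h i.castSucc) * f (A.orderEmbOfFin h i.succ) < 0).image p, x ≠ τ j) ∧
    (∀ j ∈ A, 0 < f (A.orderEmbOfFin h 0) * f j * ∏ x ∈ (Finset.univ.filter fun i : Fin k =>
        f (A.orderEmbOfFin h i.castSucc) * f (A.orderEmbOfFin h i.succ) < 0).image p, (x - τ j)) := by
  classical
  set e := A.orderEmbOfFin h with he
  set F := Finset.univ.filter fun i : Fin k => f (e i.castSucc) * f (e i.succ) < 0 with hF
  have hmono : StrictMono (fun i : Fin (k + 1) => τ (e i)) := hτ.comp (A.orderEmbOfFin h).strictMono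
  -- sides
  have hside : ∀ (i : Fin k) (i₀ : Fin (k + 1)), ((i : ℕ) < i₀ → p i < τ (e i₀)) ∧ (¬ (i : ℕ) < i₀ → τ (e i₀) < p i) := by
    intro i i₀
    constructor
    · intro hi
      exact (hp i).2.trans_le (hmono.monotone (by rw [Fin.le_def, Fin.val_succ]; omega))
    · intro hi
      exact lt_of_le_of_lt (hmono.monotone (by rw [Fin.le_def, Fin.val_castSucc]; omega)) (hp i).1
  have hpmono : StrictMono p := by
    intro i i' hii'
    have : τ (e i.succ) ≤ τ (e i'.castSucc) :=
      hmono.monotone (by rw [Fin.le_def, Fin.val_succ, Fin.val_castSucc]; exact hii')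
    exact (hp i).2.trans_le (this.trans (hp i').1.le)
  have hinj : Set.InjOn p F := hpmono.injective.injOn
  have hsurj : ∀ j ∈ A, ∃ i₀, e i₀ = j := by
    intro j hj
    have : j ∈ Set.range e := by rw [he, Finset.range_orderEmbOfFin]; exact hj
    exact this
  refine ⟨Finset.card_image_of_injOn hinj, ?_, ?_⟩
  · intro j hj x hx
    obtain ⟨i₀, rfl⟩ := hsurj j hj
    obtain ⟨i, hi, rfl⟩ := Finset.mem_image.1 hx
    by_cases hlt : (i : ℕ) < i₀
    · exact ne_of_lt ((hside i i₀).1 hlt)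
    · exact ne_of_gt ((hside i i₀).2 hlt)
  · intro j hj
    obtain ⟨i₀, rfl⟩ := hsurj j hj
    rw [Finset.prod_image hinj]
    have ha : ∀ i, (f ∘ e) i ≠ 0 := fun i => hf _ (by rw [he]; exact A.orderEmbOfFin_mem h i)
    have hrun := sign_run (f ∘ e) ha i₀
    simp only [Function.comp] at hrun
    have hset : (Finset.univ.filter fun i : Fin k => f (e i.castSucc) * f (e i.succ) < 0 ∧ (i : ℕ) < i₀) =
        F.filter fun i : Fin k => (i : ℕ) < i₀ := by
      rw [hF, Finset.filter_filter]
    rw [hset] at hrun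
    have hprod : 0 < (-1) ^ (F.filter fun i : Fin k => (i : ℕ) < i₀).card * ∏ i ∈ F, (p i - τ (e i₀)) := by
      rw [← Finset.prod_filter_mul_prod_filter_not F (fun i : Fin k => (i : ℕ) < i₀), ← mul_assoc,
        ← Finset.prod_const (-1 : ℝ), ← Finset.prod_mul_distrib]
      refine mul_pos (Finset.prod_pos fun i hi => ?_) (Finset.prod_pos fun i hi => ?_)
      · have := (hside i i₀).1 (Finset.mem_filter.1 hi).2
        linarith
      · have := (hside i i₀).2 (Finset.mem_filter.1 hi).2
        linarith
    have hkey := mul_pos hrun hprod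
    have hre : f (e 0) * f (e i₀) * (-1) ^ (F.filter fun i : Fin k => (i : ℕ) < i₀).card *
        ((-1) ^ (F.filter fun i : Fin k => (i : ℕ) < i₀).card * ∏ i ∈ F, (p i - τ (e i₀))) =
        (f (e 0) * f (e i₀) * ∏ i ∈ F, (p i - τ (e i₀))) *
          ((-1) ^ (F.filter fun i : Fin k => (i : ℕ) < i₀).card) ^ 2 := by ring
    rw [hre] at hkey
    have hsq : 0 < ((-1 : ℝ) ^ (F.filter fun i : Fin k => (i : ℕ) < i₀).card) ^ 2 := by positivity
    exact pos_of_mul_pos_left hkey hsq.le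

/-! ## Flip witnesses for the node-twisted test function -/

/-- **Flip witness.**  `g = expSum a x` (any coefficients/exponents), a finite set `Nτ` of NODES where `g` vanishes, and `s < t` with
`g(s), g(t) ≠ 0`.  If the node-twisted values `g(s)·∏(n − s)` and `g(t)·∏(n − t)` have OPPOSITE signs, then strictly between `s` and `t`
there is either a zero of `g` that is not a node, or a node at which `g′` vanishes too (parity walk + local signs at simple zeros).
[this work] -/
theorem exists_flipWitness {ι : Type*} [Fintype ι] (a x : ι → ℝ) (Nτ : Finset ℝ) (hN : ∀ n ∈ Nτ, expSum a x n = 0)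
    (s t : ℝ) (hst : s < t) (hs : expSum a x s ≠ 0) (ht : expSum a x t ≠ 0)
    (hflip : (expSum a x s * ∏ n ∈ Nτ, (n - s)) * (expSum a x t * ∏ n ∈ Nτ, (n - t)) < 0) :
    ∃ w, s < w ∧ w < t ∧ expSum a x w = 0 ∧ (w ∉ Nτ ∨ expSum (fun i => a i * x i) x w = 0) := by
  classical
  by_contra hno
  push Not at hno
  -- every zero of `g` in `[s,t]` is a node with `g′ ≠ 0`
  set g := expSum a x with hg
  set Nin : Finset ℝ := Nτ.filter fun n => s < n ∧ n < t with hNin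
  have hz : ∀ w, s ≤ w → w ≤ t → g w = 0 → w ∈ Nin := by
    intro w h1 h2 hw
    rcases eq_or_lt_of_le h1 with rfl | h1'
    · exact absurd hw hs
    rcases eq_or_lt_of_le h2 with rfl | h2'
    · exact absurd hw ht
    have := hno w h1' h2' hw
    exact Finset.mem_filter.2 ⟨this.1, h1', h2'⟩
  have hsimple : ∀ n ∈ Nin, ∃ d η : ℝ, 0 < η ∧ (∀ u, n < u → u < n + η → 0 < d * g u) ∧
      (∀ u, n - η < u → u < n → d * g u < 0) := by
    intro n hn
    obtain ⟨hnN, h1, h2⟩ := Finset.mem_filter.1 hn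
    have hd : expSum (fun i => a i * x i) x n ≠ 0 := fun h => (hno n h1 h2 (hN n hnN)).2 h
    obtain ⟨η, hη, hR, hL⟩ := expSum_sign_near_simple a x n (hN n hnN) hd
    exact ⟨_, η, hη, hR, hL⟩
  have hwalk := sign_walk g (continuous_expSum a x) t Nin hsimple s hst
    (fun n hn => let h := Finset.mem_filter.1 hn; ⟨h.2.1, h.2.2⟩) hz
  -- sign of the node products
  have hprod : 0 < (∏ n ∈ Nτ, (n - s)) * (∏ n ∈ Nτ, (n - t)) * (-1) ^ Nin.card := by
    have hsplit : (∏ n ∈ Nτ, (n - s)) * (∏ n ∈ Nτ, (n - t)) * (-1) ^ Nin.card =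
        ∏ n ∈ Nτ, ((n - s) * (n - t) * (if s < n ∧ n < t then -1 else 1)) := by
      rw [Finset.prod_mul_distrib, Finset.prod_mul_distrib, Finset.prod_ite, Finset.prod_const_one, mul_one,
        Finset.prod_const, hNin]
    rw [hsplit]
    refine Finset.prod_pos fun n hn => ?_
    have hns : n ≠ s := fun h => hs (h ▸ hN n hn)
    have hnt : n ≠ t := fun h => ht (h ▸ hN n hn)
    by_cases hin : s < n ∧ n < t
    · rw [if_pos hin]; nlinarith [hin.1, hin.2]
    · rw [if_neg hin, mul_one]
      rcases lt_or_gt_of_ne hns with h | h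
      · have : n < t := h.trans hst
        nlinarith
      · have h' : t < n := lt_of_le_of_ne (not_lt.1 fun h'' => hin ⟨h, h''⟩) hnt.symm
        nlinarith
  -- combine: the flip says the twisted product is negative, the walk says it is positive
  have key : (g s * ∏ n ∈ Nτ, (n - s)) * (g t * ∏ n ∈ Nτ, (n - t)) * ((-1) ^ Nin.card * (-1) ^ Nin.card) =
      (g s * g t * (-1) ^ Nin.card) * ((∏ n ∈ Nτ, (n - s)) * (∏ n ∈ Nτ, (n - t)) * (-1) ^ Nin.card) := by ring
  have hsq : ((-1 : ℝ) ^ Nin.card * (-1) ^ Nin.card) = 1 := by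
    rw [← mul_pow]; norm_num
  have := mul_pos hwalk hprod
  rw [← key, hsq, mul_one] at this
  exact absurd hflip (not_lt.2 this.le)

end Summit.ValiantsHypothesis.ValiantsHypothesis.Theorems.LacunarySymmetroidMatrixDescartes.WallBubbling
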